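import Summits.AtomisticToContinuum.BoseEinsteinCondensation.Theorems.BECInsertionVarianceGroundStateAccessibleHardCoreGlue
import HarnessLib

/-!
# `GroundStateAccessible`, hard-core branch: the two mass defects (measure form of SUPPORT and DENSITY)

Helper for item `GroundStateAccessible` (stmt-AtomisticToContinuum-12069) of route `BECInsertionVariance`
(`Summit.AtomisticToContinuum.BoseEinsteinCondensation.Theses.BECInsertionVariance.GroundStateAccessible`).

`…GroundStateAccessibleHardCoreGlue.lean` isolates the unbounded-potential branch of the item as SUPPORT
(an ALMOST-EVERYWHERE statement: a.e. non-cross-close pair keeps both swapped configurations in the support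
of `Ψ₀`) plus DENSITY (the `p`-mass of the cross-close pairs is `≤ 1/2`). For hard spheres the a.e. form of
SUPPORT is too strong — whenever the accessible region has a jammed component that can be COMPLETED by
inserting one sphere into a fluid configuration, a set of pairs of positive `p`-measure leaves the support
without being cross-close — while only a MEASURE bound is needed. This file records the honest, weaker
bookkeeping: the inaccessible mass `p({q = 0})` splits along the cross-close event `E_R` into

* the SUPPORT DEFECT `p({q = 0} ∖ E_R)` — teleported bosons land outside every range-`R` ball of the
  receiving replica and still leave the support (insertion instability of the minimising component), and
* the DENSITY DEFECT `p(E_R)` — a teleported boson lands within `R` of a particle of the other replica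
  (a one-body density statement),

and `swapMass ≥ 1 − (support defect) − (density defect)`; with both defects `≤ 1/4` the accessible mass
is `≥ 1/2` (`half_le_swapMass_of_defects_le`), and the eventual forms along `L = ((n+1)/ρ)^{1/3}` give
the hard-core branch (H) of `groundStateAccessible_of_unbounded` (`hardBranch_of_defects_le`). Pure
measure bookkeeping; the two defect bounds are the open content of the item for unbounded `v`.
-/

noncomputable section

open MeasureTheory Filter Set
open scoped ENNReal NNReal Topology

namespace Summit.AtomisticToContinuum.BoseEinsteinCondensation.Theorems.BECInsertionVariance

open Literature.MathematicalPhysics.QuantumManyBody.BoseGas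

variable {n : ℕ}

/-- **Mass balance of the two-replica picture.** For a measurable real `Φ` with `∫ Φ² = 1`:
`1 ≤ swapMass n Φ + p({q = 0} ∖ E) + p(E)` for every measurable event `E` of pairs, where
`p = Φ² ⊗ Φ²` and `q` is the swapped density (total mass `1` split along `{q ≠ 0}`, `{q = 0} ∖ E`,
`{q = 0} ∩ E ⊆ E`). [folklore] -/
theorem one_le_swapMass_add_defects {Φ : Config (n + 1) → ℝ} (hΦ : Measurable Φ)
    (h1 : ∫⁻ X, ENNReal.ofReal (Φ X ^ 2) = 1) (E : Set (Config (n + 1) × Config (n + 1))) :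
    (1 : ℝ≥0∞) ≤ swapMass n Φ +
      (∫⁻ Z in {Z | swappedDensity Φ Z = 0} \ E, ENNReal.ofReal (replicaDensity Φ Z)) +
      ∫⁻ Z in E, ENNReal.ofReal (replicaDensity Φ Z) := by
  set f : Config (n + 1) × Config (n + 1) → ℝ≥0∞ := fun Z => ENNReal.ofReal (replicaDensity Φ Z)
    with hfdef
  have hG : MeasurableSet {Z : Config (n + 1) × Config (n + 1) | swappedDensity Φ Z ≠ 0} :=
    measurableSet_swappedDensity_ne_zero hΦ
  -- total mass `1`
  have htot : ∫⁻ Z, f Z = 1 := by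
    rw [hfdef, lintegral_replicaDensity hΦ, h1, one_pow]
  -- split along `{q ≠ 0}`
  have hcompl : ({Z : Config (n + 1) × Config (n + 1) | swappedDensity Φ Z ≠ 0})ᶜ =
      {Z | swappedDensity Φ Z = 0} := by
    ext Z
    simp
  have hsplit : ∫⁻ Z, f Z = swapMass n Φ + ∫⁻ Z in {Z | swappedDensity Φ Z = 0}, f Z := by
    rw [← lintegral_add_compl f hG, hcompl]
    rfl
  -- split `{q = 0}` along `E`
  have hbad : ∫⁻ Z in {Z | swappedDensity Φ Z = 0}, f Z ≤
      (∫⁻ Z in {Z | swappedDensity Φ Z = 0} \ E, f Z) + ∫⁻ Z in E, f Z := by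
    calc ∫⁻ Z in {Z | swappedDensity Φ Z = 0}, f Z
        = ∫⁻ Z in ({Z | swappedDensity Φ Z = 0} \ E) ∪ ({Z | swappedDensity Φ Z = 0} ∩ E), f Z := by
          rw [sdiff_union_inter]
      _ ≤ (∫⁻ Z in {Z | swappedDensity Φ Z = 0} \ E, f Z) +
            ∫⁻ Z in {Z | swappedDensity Φ Z = 0} ∩ E, f Z := lintegral_union_le _ _ _
      _ ≤ (∫⁻ Z in {Z | swappedDensity Φ Z = 0} \ E, f Z) + ∫⁻ Z in E, f Z :=
          add_le_add le_rfl (lintegral_mono_set inter_subset_right)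
  calc (1 : ℝ≥0∞) = swapMass n Φ + ∫⁻ Z in {Z | swappedDensity Φ Z = 0}, f Z := by rw [← hsplit, htot]
    _ ≤ swapMass n Φ + ((∫⁻ Z in {Z | swappedDensity Φ Z = 0} \ E, f Z) + ∫⁻ Z in E, f Z) :=
        add_le_add le_rfl hbad
    _ = _ := (add_assoc _ _ _).symm

/-- **Support defect + density defect `≤ 1/4` each ⇒ accessible swap mass `≥ 1/2`.** Let `Φ` be a
measurable real wave function of `n + 1` particles with `∫ Φ² = 1` and `R` a length; write `E_R` for the
cross-close pairs (particle `0` of one replica within `R` of another particle of the other replica). If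
the SUPPORT DEFECT `p({q = 0} ∖ E_R)` and the DENSITY DEFECT `p(E_R)` are both `≤ 1/4`, then
`1/2 ≤ swapMass n Φ`. (Measure form of `half_le_swapMass_of_support_of_density`, whose a.e. support
hypothesis is the case "support defect `= 0`".) [folklore] -/
theorem half_le_swapMass_of_defects_le {Φ : Config (n + 1) → ℝ} (hΦ : Measurable Φ)
    (h1 : ∫⁻ X, ENNReal.ofReal (Φ X ^ 2) = 1) (R : ℝ)
    (hsupp : ∫⁻ Z in {Z : Config (n + 1) × Config (n + 1) | swappedDensity Φ Z = 0} \
        {Z | ∃ j : Fin (n + 1), j ≠ 0 ∧ (dist (Z.2 0) (Z.1 j) ≤ R ∨ dist (Z.1 0) (Z.2 j) ≤ R)},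
        ENNReal.ofReal (replicaDensity Φ Z) ≤ 1 / 4)
    (hdens : ∫⁻ Z in {Z : Config (n + 1) × Config (n + 1) |
        ∃ j : Fin (n + 1), j ≠ 0 ∧ (dist (Z.2 0) (Z.1 j) ≤ R ∨ dist (Z.1 0) (Z.2 j) ≤ R)},
        ENNReal.ofReal (replicaDensity Φ Z) ≤ 1 / 4) :
    1 / 2 ≤ swapMass n Φ := by
  have h := one_le_swapMass_add_defects hΦ h1
    {Z : Config (n + 1) × Config (n + 1) |
      ∃ j : Fin (n + 1), j ≠ 0 ∧ (dist (Z.2 0) (Z.1 j) ≤ R ∨ dist (Z.1 0) (Z.2 j) ≤ R)}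
  have hle : (1 : ℝ≥0∞) ≤ swapMass n Φ + (1 / 4 + 1 / 4) := by
    calc (1 : ℝ≥0∞) ≤ _ := h
      _ ≤ swapMass n Φ + (1 / 4 + 1 / 4) := by
          rw [add_assoc]
          exact add_le_add le_rfl (add_le_add hsupp hdens)
  have hq : (1 / 4 + 1 / 4 : ℝ≥0∞) = 1 / 2 := by
    rw [← two_mul, ENNReal.div_eq_inv_mul, ENNReal.div_eq_inv_mul, mul_one, mul_one,
      show (4 : ℝ≥0∞) = 2 * 2 by norm_num, ENNReal.mul_inv (Or.inl two_ne_zero) (Or.inl ENNReal.ofNat_ne_top),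
      ← mul_assoc, ENNReal.mul_inv_cancel two_ne_zero ENNReal.ofNat_ne_top, one_mul]
  rw [hq] at hle
  calc (1 / 2 : ℝ≥0∞) = 1 - 1 / 2 := by norm_num [ENNReal.sub_half]
    _ ≤ swapMass n Φ := tsub_le_iff_left.2 (by rwa [add_comm] at hle)

/-- **The hard-core branch (H) from eventual bounds on the two defects of `groundState`.** For every
UNBOUNDED repulsive finite-range `v` and a length `R`: if along `L = ((n+1)/ρ)^{1/3}`, for small `ρ` and
all large `n`, the nonnegative ground state `Ψ₀ = groundState v (n+1) L` is normalised and both its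
support defect `p({q = 0} ∖ E_R)` and its density defect `p(E_R)` are `≤ 1/4`, then its accessible swap
mass is eventually `≥ 1/2` — hypothesis (H) of `groundStateAccessible_of_unbounded`, hence
`GroundStateAccessible`. The two defect bounds are exactly what remains of the item. [folklore] -/
theorem hardBranch_of_defects_le
    (hSD : ∀ v : ℝ → ℝ≥0∞, IsRepulsiveFiniteRange v → (¬ ∃ C : ℝ≥0, ∀ r, v r ≤ C) →
      ∃ (R ρ₀ : ℝ), 0 < ρ₀ ∧ ∀ ρ : ℝ, 0 < ρ → ρ < ρ₀ → ∀ᶠ n : ℕ in atTop,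
        (∫⁻ X, ENNReal.ofReal (groundState v (n + 1) (sideLength ρ (n + 1)) X ^ 2) = 1) ∧
        (∫⁻ Z in {Z : Config (n + 1) × Config (n + 1) |
              swappedDensity (groundState v (n + 1) (sideLength ρ (n + 1))) Z = 0} \
            {Z | ∃ j : Fin (n + 1), j ≠ 0 ∧ (dist (Z.2 0) (Z.1 j) ≤ R ∨ dist (Z.1 0) (Z.2 j) ≤ R)},
          ENNReal.ofReal (replicaDensity (groundState v (n + 1) (sideLength ρ (n + 1))) Z) ≤ 1 / 4) ∧
        (∫⁻ Z in {Z : Config (n + 1) × Config (n + 1) |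
            ∃ j : Fin (n + 1), j ≠ 0 ∧ (dist (Z.2 0) (Z.1 j) ≤ R ∨ dist (Z.1 0) (Z.2 j) ≤ R)},
          ENNReal.ofReal (replicaDensity (groundState v (n + 1) (sideLength ρ (n + 1))) Z) ≤ 1 / 4)) :
    ∀ v : ℝ → ℝ≥0∞, IsRepulsiveFiniteRange v → (¬ ∃ C : ℝ≥0, ∀ r, v r ≤ C) →
      ∃ ρ₀ : ℝ, 0 < ρ₀ ∧ ∀ ρ : ℝ, 0 < ρ → ρ < ρ₀ → ∀ᶠ n : ℕ in atTop,
        (1 / 2 : ℝ≥0∞) ≤ swapMass n (groundState v (n + 1) (sideLength ρ (n + 1))) := by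
  intro v hv hb
  obtain ⟨R, ρ₀, hρ₀, h⟩ := hSD v hv hb
  refine ⟨ρ₀, hρ₀, fun ρ hρ hρ' => ?_⟩
  filter_upwards [h ρ hρ hρ'] with n hn
  obtain ⟨h1, hsupp, hdens⟩ := hn
  exact half_le_swapMass_of_defects_le (measurable_groundState v (n + 1) _) h1 R hsupp hdens

end Summit.AtomisticToContinuum.BoseEinsteinCondensation.Theorems.BECInsertionVariance

end
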